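import Summits.BirchSwinnertonDyer.BirchSwinnertonDyer.Theorems.ResidualThetaTransportAtTwoCohomologicalPlusPeriodSupplyPeriods
import Summits.BirchSwinnertonDyer.BirchSwinnertonDyer.Theses.ResidualThetaTransportAtTwo
import HarnessLib

/-!
# Support item `CohomologicalPlusPeriodSupply` (stmt-BirchSwinnertonDyer-22892) BY NAME

Route `ResidualThetaTransportAtTwo`: every newform `g` on `Γ₀(M)` (`IsNewform0`) has a COHOMOLOGICAL plus
period along every embedding `ι : K_g → ℚ̄₂` (Pollack–Weston 2011, Def. 2.1 "such periods clearly always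
exist") — the registered (coh) stub `stub_exists_cohomologicalPlusPeriod` of the cruxes K0⁺
`HeckeThetaPartnerAdicAtTwo` (stmt-BirchSwinnertonDyer-20690) and Kan⁺ `ThetaLayerLambdaCongruenceAtTwo`
(stmt-BirchSwinnertonDyer-20688).  One-line corollary of
`CohomologicalPeriod.exists_isCohomologicalPlusPeriod` (any prime `p`; companion file
`…CohomologicalPlusPeriodSupplyPeriods.lean`: Shimura period, Manin's trick, ultrametric maximum,
rescaling).  THEOREMS ONLY.
-/

set_option autoImplicit false
set_option linter.dupNamespace false

namespace Summit.BirchSwinnertonDyer.BirchSwinnertonDyer.Theorems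

/-- **Support item `CohomologicalPlusPeriodSupply` (stmt-BirchSwinnertonDyer-22892) BY NAME** — the
registered (coh) stub of the cruxes K0⁺ (20690) and Kan⁺ (20688) of route `ResidualThetaTransportAtTwo`:
every newform on `Γ₀(M)` has a cohomological plus period along every embedding `K_g → ℚ̄₂`
(`CohomologicalPeriod.exists_isCohomologicalPlusPeriod` at `p = 2`). [cite: PollackWeston2011MT, Def. 2.1] -/
theorem cohomologicalPlusPeriodSupply_proof :
    Summit.BirchSwinnertonDyer.BirchSwinnertonDyer.Theses.ResidualThetaTransportAtTwo.CohomologicalPlusPeriodSupply := by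
  intro M _ g ι hg
  exact CohomologicalPeriod.exists_isCohomologicalPlusPeriod hg ι

end Summit.BirchSwinnertonDyer.BirchSwinnertonDyer.Theorems
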